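import Mathlib
import HarnessLib.Audit
import Summits.PneNP.PneNP.Theorems.PstarNorUnitEQ1Three
import Summits.PneNP.PneNP.Theorems.PstarChordBridgeAssemble
import Summits.PneNP.PneNP.Theorems.PstarUnionRankSix

/-!
# Chord-pair surjectivity: two chords of a core are jointly free (ROUND-24, memo §14.21 B-I CORE; typed sketch `r24/SketchCaseB.lean` of planner p3 g22)

FRONTIER range-avoidance ladder, rung F-N3, ROUND 24 (cell `pnp-ideate`, planner memo `r24/CORE-BOUND-NOTES.md` §14.21 (Case B of the union lemma), typed statement
`chordPair_surjective` of `r24/SketchCaseB.lean` VERBATIM; restricted-model proof complexity — nothing here bears on `P` versus `NP`).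

**CORE (reader-free).**  For two distinct chords `c ≠ c'` of a maximal peelable `F ⊆ J₀` (pure typed instance with simple overlaps, `(r,3/2)`-expanding, `#J₀ < r`) and any
target pattern `(α, β)` there is an assignment solving `J₀ − c − c'` with all four privates `1` under which `c` holds iff `α` and `c'` holds iff `β`.  Equivalently: the pair
of prescribed products `(u_c, u_{c'}) = (γ_c + Q_{D c}, γ_{c'} + Q_{D c'})` is SURJECTIVE onto `𝔽₂²`.

Proof.  `exists_cycleData` packages the core with chord set `J₀ ∖ F`, EMPTY reader and the "constraint" `q := u_c + κ₁` whose join is the fundamental set `D c` itself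
(odd vertices of `D c` = the XOR ends of `c`) — well-formed liftable bridge data `B̃` with `polarDir I B̃ (1,0) = polar (D c)` (`polarDir_cycle`).  If `u_{c'}` were
constant on `{u_c = κ₁}`, `PstarForcing.forcing_cases (q, Q_{D c'})` (rank `≥ 4`, `PstarChordBridgeForcing.rank_four_of_wf`) would give: `q ≡ 1` — excluded by the rank of
`Q_{D c}`; (EQ) `Q_{D c'} = Q_{D c} + const` — then `D c = D c'` and `c = c'`; (NOR) — `q` a product, rank `≤ 2`; (EXC) — by `PstarNorUnitExcCore.exc_unit_core` against `B̃`,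
`D c' = {j₁, j₂}` is a CONS-T pair and `D c = D c' + g` with `g`'s AND pair straddling those of `j₁, j₂`; but then an XOR end of `g` off `c` has odd degree in `D c'`
(`D c + c` is even), so `g` shares an XOR vertex AND an AND variable with `j₁` or `j₂` — two shared variables, excluded by simple overlaps (`false_of_straddle`).  The
assignment is then produced by the lift and `setPriv` (`chordPair_surjective`).
-/

set_option linter.dupNamespace false -- `Summit.PneNP.PneNP.…`: summit = sub-problem name (D-0017 single-conjunct layout)

open Finset Module Literature.Computability.Complexity
open Summit.PneNP.PneNP.Theorems.PstarFibrePolys (bit bit_injective)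
open Summit.PneNP.PneNP.Theorems.PstarTyped (Typed)
open Summit.PneNP.PneNP.Theorems.PstarSALevel (varSet bdry BoundaryExpanding SimpleOverlap)
open Summit.PneNP.PneNP.Theorems.PstarCoreBound (XorClosed)
open Summit.PneNP.PneNP.Theorems.PstarGapLinearised (andPair andPair_subset_varSet)
open Summit.PneNP.PneNP.Theorems.PstarChordEndgameTools (mem_andPair_iff not_two_shared)
open Summit.PneNP.PneNP.Theorems.PstarCentreFree (vars_mem_varSet)
open Summit.PneNP.PneNP.Theorems.PstarXorElimination (pdeg)
open Summit.PneNP.PneNP.Theorems.PstarXCore (xpair xverts mem_xpair)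
open Summit.PneNP.PneNP.Theorems.PstarCubeIdeals (IsAffineFn)
open Summit.PneNP.PneNP.Theorems.PstarQuadRank (rad)
open Summit.PneNP.PneNP.Theorems.PstarForcing (polar_unique forcing_cases exists_ne_of_rank_four not_rank_four_of_mul)
open Summit.PneNP.PneNP.Theorems.PstarProductRank (qform polar polar_apply)
open Summit.PneNP.PneNP.Theorems.PstarPathRank (AndAdj polar_basis andPair_ne)
open Summit.PneNP.PneNP.Theorems.PstarChordRepair (IsChord)
open Summit.PneNP.PneNP.Theorems.PstarChordBridgeTools
open Summit.PneNP.PneNP.Theorems.PstarChordBridge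
open Summit.PneNP.PneNP.Theorems.PstarReadSumset (V2)
open Summit.PneNP.PneNP.Theorems.PstarChordBridgeFundamental (xpdeg_insert odd_of_end mem_xpair_of_odd exists_mem_of_odd two_le_card_of_even eq_of_fundamental_eq)
open Summit.PneNP.PneNP.Theorems.PstarChordBridgeForcing (freeMon freePolar gam sys_u_eq qform_add' rank_four_of_wf eq_of_qform_eq)
open Summit.PneNP.PneNP.Theorems.PstarChordBridgeLift (lift_of_wf_peelable)
open Summit.PneNP.PneNP.Theorems.PstarChordBridgeCotree (Peelable exists_fundamental_of_maximal)
open Summit.PneNP.PneNP.Theorems.PstarChordBridgeBasis (qDir polarDir)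
open Summit.PneNP.PneNP.Theorems.PstarChordBridgeCorner (andAdj_iff_mem qDir_add)
open Summit.PneNP.PneNP.Theorems.PstarNorUnitExcCore (exc_unit_core)

namespace Summit.PneNP.PneNP.Theorems.PstarUnionChordPair

variable {n m : ℕ}

/-! ## Cycle data: the core with empty reader and the fundamental set of `c` as second join -/

/-- **Cycle data.**  For a maximal peelable `F ⊆ J₀` whose complement consists of chords and a chord `c`, there is well-formed liftable bridge data with core `J₀`,
chords `J₀ ∖ F`, empty first constraint, and second "constraint" `x_{u(c)} + x_{v(c)}` whose join is `D c` (no monomials). -/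
theorem exists_cycleData (I : LocalMap 4 n m) (hI : I.IsPure xorAndPred) (hT : Typed I) (y : Fin m → Bool) {J₀ F : Finset (Fin m)}
    (hF : F ⊆ J₀) (hP : Peelable I F) (hmax : ∀ F', F ⊆ F' → F' ⊆ J₀ → Peelable I F' → F' = F) (hchord : ∀ e ∈ J₀ \ F, IsChord I J₀ e)
    {c : Fin m} (hc : c ∈ J₀ \ F) :
    ∃ B : BridgeData n m, B.y = y ∧ B.J₀ = J₀ ∧ B.N = J₀ \ F ∧ B.T₁ = ∅ ∧ B.G₁ = ∅ ∧ B.T₂ = B.D c ∧ B.G₂ = ∅ ∧ B.WF I ∧ Lift I B := by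
  classical
  have hFN : J₀ \ (J₀ \ F) = F := Finset.sdiff_sdiff_eq_self hF
  have hfund : ∀ e, ∃ D : Finset (Fin m), e ∈ J₀ \ F → D ⊆ F ∧ e ∉ D ∧ ∀ w, Even (xpdeg I (insert e D) w) := by
    intro e
    by_cases he : e ∈ J₀ \ F
    · obtain ⟨D, hD, heD, hev⟩ := exists_fundamental_of_maximal I hI hF hP hmax he
      exact ⟨D, fun _ => ⟨hD, heD, hev⟩⟩
    · exact ⟨∅, fun h => absurd h he⟩
  choose D hD using hfund
  obtain ⟨hDc, hcD, hevc⟩ := hD c hc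
  let B : BridgeData n m :=
    { y := y, J₀ := J₀, N := J₀ \ F, D := D, C₁ := ∅, G₁ := ∅, b₁ := false, T₁ := ∅,
      C₂ := xpair I c, G₂ := ∅, b₂ := false, T₂ := D c }
  have h0odd : ∀ w : Fin n, ¬ Odd (xpdeg I (∅ : Finset (Fin m)) w) := by
    intro w h
    have h0 : xpdeg I (∅ : Finset (Fin m)) w = 0 := by simp [xpdeg, pdeg]
    rw [h0] at h
    exact (by decide : ¬ Odd 0) h
  have hW : B.WF I :=
    { hN := sdiff_subset
      hchord := hchord
      hD := fun e he => by show D e ⊆ J₀ \ (J₀ \ F); rw [hFN]; exact (hD e he).1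
      hDeven := fun e he => (hD e he).2.2
      hT₁ := empty_subset _
      hT₂ := by show D c ⊆ J₀ \ (J₀ \ F); rw [hFN]; exact hDc
      hjoin₁ := fun w => ⟨fun h => (h0odd w h).elim, fun h => absurd h.1 (notMem_empty w)⟩
      hjoin₂ := fun w => by
        show Odd (xpdeg I (D c) w) ↔ w ∈ xpair I c ∧ w ∈ xverts I (J₀ \ (J₀ \ F))
        rw [hFN]
        constructor
        · intro h
          refine ⟨mem_xpair_of_odd I hcD hevc h, ?_⟩
          obtain ⟨j, hj, hwj⟩ := exists_mem_of_odd I h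
          exact mem_biUnion.2 ⟨j, hDc hj, hwj⟩
        · rintro ⟨h, -⟩
          rcases (mem_xpair I).1 h with rfl | rfl
          · exact odd_of_end I hI hcD hevc (s := 0) (by decide)
          · exact odd_of_end I hI hcD hevc (s := 1) (by decide)
      hcross₁ := fun g hg => absurd hg (notMem_empty g)
      hcross₂ := fun g hg => absurd hg (notMem_empty g) }
  have hL : Lift I B := lift_of_wf_peelable I hI hT B (by show Peelable I (J₀ \ (J₀ \ F)); rw [hFN]; exact hP)
  exact ⟨B, rfl, rfl, rfl, rfl, rfl, rfl, rfl, hW, hL⟩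

/-- The direction form of cycle data is the polar form of `Q_{D c}`. -/
theorem polarDir_cycle (I : LocalMap 4 n m) {B : BridgeData n m} {c : Fin m} (hT₂ : B.T₂ = B.D c) (hG₂ : B.G₂ = ∅) :
    polarDir I B ((1 : ZMod 2), (0 : ZMod 2)) = polar (B.D c) (fun j => I.vars j 2) (fun j => I.vars j 3) := by
  have hfm : freeMon I B.N (∅ : Finset (Fin m)) = ∅ := by
    unfold PstarChordBridgeForcing.freeMon
    exact filter_empty _
  unfold polarDir freePolar
  rw [zero_smul, one_smul, zero_add, hT₂, hG₂, hfm]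
  refine LinearMap.ext₂ fun v w => ?_
  rw [LinearMap.add_apply, LinearMap.add_apply, polar_apply, polar_apply, sum_empty, add_zero]

/-! ## The straddling output is impossible -/

/-- **No straddle.**  If the fundamental sets of two chords `c, c'` satisfy `D c = D c' + g` with `D c' = {j₁, j₂}` and the AND pair of `g ∈ D c` meets those of both
`j₁` and `j₂`, simple overlaps are violated: an XOR end of `g` off `c` has odd degree in `D c'`, so `g` shares an XOR vertex and an AND variable with `j₁` or `j₂`. -/
theorem false_of_straddle (I : LocalMap 4 n m) (hI : I.IsPure xorAndPred) (hS : SimpleOverlap I) {Dc Dc' : Finset (Fin m)} {c g j₁ j₂ : Fin m}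
    (hcD : c ∉ Dc) (hev : ∀ w, Even (xpdeg I (insert c Dc) w)) (hgc : g ≠ c)
    (hDc : Dc = insert g Dc') (hgD : g ∉ Dc') (hDc' : Dc' = {j₁, j₂}) (hg₁ : g ≠ j₁) (hg₂ : g ≠ j₂)
    {σ τ : Fin n} (hσ : σ ∈ andPair I j₁) (hτ : τ ∈ andPair I j₂) (hσg : σ ∈ andPair I g) (hτg : τ ∈ andPair I g) : False := by
  classical
  have hinj := hI.2 g
  -- an XOR end `s` of `g` that is not an XOR end of `c`
  obtain ⟨s, hs, hsg, hsc⟩ : ∃ s : Fin 4, s.val < 2 ∧ I.vars g s ∈ xpair I g ∧ I.vars g s ∉ xpair I c := by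
    by_contra hno
    push Not at hno
    have h0 := hno 0 (by decide) ((mem_xpair I).2 (Or.inl rfl))
    have h1 := hno 1 (by decide) ((mem_xpair I).2 (Or.inr rfl))
    exact PstarChordBridgeFundamental.false_of_both_ends I hI hS hgc.symm h0 h1
  -- its degree in `D c'` is odd
  have hodd : Odd (xpdeg I Dc' (I.vars g s)) := by
    have h := hev (I.vars g s)
    rw [xpdeg_insert I hcD, hDc, xpdeg_insert I hgD] at h
    have hc0 : I.vars c 0 ≠ I.vars g s := fun e => hsc ((mem_xpair I).2 (Or.inl e.symm))
    have hc1 : I.vars c 1 ≠ I.vars g s := fun e => hsc ((mem_xpair I).2 (Or.inr e.symm))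
    rw [if_neg hc0, if_neg hc1, add_zero, add_zero] at h
    have hone : (if I.vars g 0 = I.vars g s then 1 else 0) + (if I.vars g 1 = I.vars g s then 1 else 0) = (1 : ℕ) := by
      have h01 : I.vars g 0 ≠ I.vars g 1 := fun e => absurd (hinj e) (by decide)
      have : s = 0 ∨ s = 1 := by
        rcases s with ⟨_ | _ | k, hk⟩
        · exact Or.inl rfl
        · exact Or.inr rfl
        · simp at hs
      rcases this with rfl | rfl
      · rw [if_pos rfl, if_neg (Ne.symm h01)]
      · rw [if_neg h01, if_pos rfl]
    rw [add_assoc, hone] at h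
    rcases Nat.even_or_odd (xpdeg I Dc' (I.vars g s)) with he | ho
    · exact absurd h (Nat.not_even_iff_odd.2 (Even.add_one he))
    · exact ho
  -- so `s` is an XOR end of `j₁` or `j₂`
  obtain ⟨j, hj, hsj⟩ := exists_mem_of_odd I hodd
  rw [hDc', mem_insert, mem_singleton] at hj
  -- two shared variables with that output
  have hsv : I.vars g s ∈ varSet I g := vars_mem_varSet I g s
  have hxv : ∀ {j : Fin m}, I.vars g s ∈ xpair I j → I.vars g s ∈ varSet I j := fun {j} h => by
    rcases (mem_xpair I).1 h with e | e
    · rw [e]; exact vars_mem_varSet I j 0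
    · rw [e]; exact vars_mem_varSet I j 1
  have hne_and : ∀ {v : Fin n}, v ∈ andPair I g → I.vars g s ≠ v := by
    intro v hv e
    rcases (mem_andPair_iff I g v).1 hv with h2 | h3
    · have := hinj (e.trans h2); rw [Fin.ext_iff] at this; simp at this; omega
    · have := hinj (e.trans h3); rw [Fin.ext_iff] at this; simp at this; omega
  rcases hj with rfl | rfl
  · exact not_two_shared I hS hg₁ (hne_and hσg) hsv (hxv hsj) (andPair_subset_varSet I g hσg) (andPair_subset_varSet I j hσ)
  · exact not_two_shared I hS hg₂ (hne_and hτg) hsv (hxv hsj) (andPair_subset_varSet I g hτg) (andPair_subset_varSet I j hτ)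

/-! ## Surjectivity of the two prescribed products -/

/-- **The pair `(u_c, u_{c'})` is onto `𝔽₂²`** for cycle data of two distinct chords (pure, simple overlaps, `(r,3/2)`-expanding, `#J₀ ≤ r`). -/
theorem exists_base (I : LocalMap 4 n m) (hI : I.IsPure xorAndPred) (hS : SimpleOverlap I) {r : ℕ} (hB : BoundaryExpanding r I)
    {B : BridgeData n m} (hW : B.WF I) (hr : B.J₀.card ≤ r) {c c' : Fin m} (hc : c ∈ B.N) (hc' : c' ∈ B.N) (hne : c ≠ c')
    (hT₁ : B.T₁ = ∅) (hG₁ : B.G₁ = ∅) (hT₂ : B.T₂ = B.D c) (hG₂ : B.G₂ = ∅) (κ₁ κ₂ : ZMod 2) :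
    ∃ a : Fin n → ZMod 2, uval I B.y (B.D c) c a = κ₁ ∧ uval I B.y (B.D c') c' a = κ₂ := by
  classical
  have z01 : ∀ t : ZMod 2, t = 0 ∨ t = 1 := by decide
  have hcD : c ∉ B.D c := fun h => (mem_sdiff.1 (hW.hD c hc h)).2 hc
  have hcD' : c' ∉ B.D c' := fun h => (mem_sdiff.1 (hW.hD c' hc' h)).2 hc'
  have hr' : (B.J₀ ∪ B.G₁ ∪ B.G₂).card ≤ r := by rw [hG₁, hG₂, union_empty, union_empty]; exact hr
  have heG : c' ∉ B.G₁ ∪ B.G₂ := by rw [hG₁, hG₂, union_empty]; exact notMem_empty _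
  have hu : ∀ e x, uval I B.y (B.D e) e x = gam B e + qform (B.D e) (fun j => I.vars j 2) (fun j => I.vars j 3) x := fun e x => by
    rw [← sys_u]; exact sys_u_eq I B e x
  have hpol := polarDir_cycle I hT₂ hG₂
  by_contra hno
  push Not at hno
  -- `q := u_c + κ₁`, polar form `polar (D c) = polarDir (1,0)`
  set q : (Fin n → ZMod 2) → ZMod 2 := fun x => uval I B.y (B.D c) c x + κ₁ with hq
  have hqB : ∀ x w, q (x + w) = q x + q w + q 0 + polarDir I B ((1 : ZMod 2), (0 : ZMod 2)) x w := by
    intro x w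
    show uval I B.y (B.D c) c (x + w) + κ₁ = uval I B.y (B.D c) c x + κ₁ + (uval I B.y (B.D c) c w + κ₁)
      + (uval I B.y (B.D c) c (0 : Fin n → ZMod 2) + κ₁) + polarDir I B ((1 : ZMod 2), (0 : ZMod 2)) x w
    rw [hpol, hu, hu, hu, hu, qform_add' I (B.D c)]
    generalize qform (B.D c) (fun j => I.vars j 2) (fun j => I.vars j 3) x = s
    generalize qform (B.D c) (fun j => I.vars j 2) (fun j => I.vars j 3) w = s'
    generalize qform (B.D c) (fun j => I.vars j 2) (fun j => I.vars j 3) (0 : Fin n → ZMod 2) = s₀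
    generalize polar (B.D c) (fun j => I.vars j 2) (fun j => I.vars j 3) x w = t; generalize gam B c = g; generalize κ₁ = k
    revert s s' s₀ t g k; decide
  have hqB' : ∀ x w, q (x + w) = q x + q w + q 0 + polar (B.D c) (fun j => I.vars j 2) (fun j => I.vars j 3) x w := by
    intro x w; rw [← hpol]; exact hqB x w
  -- `Q_{D c'}` is constant on `Z(q)`
  have hZ : ∀ x, q x = 0 → qform (B.D c') (fun j => I.vars j 2) (fun j => I.vars j 3) x = gam B c' + κ₂ + 1 := by
    intro x hx
    have h1 : uval I B.y (B.D c) c x = κ₁ := by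
      have e : ∀ u k : ZMod 2, u + k = 0 → u = k := by decide
      exact e _ _ hx
    have h2 := hno x h1
    rw [hu] at h2
    revert h2
    generalize qform (B.D c') (fun j => I.vars j 2) (fun j => I.vars j 3) x = s; generalize gam B c' = g; generalize κ₂ = k
    revert s g k; decide
  have hrank := rank_four_of_wf I hI hS hB hW hr hc
  have hrank' := rank_four_of_wf I hI hS hB hW hr hc'
  -- (EQ) against `q` is impossible: equal fundamental sets
  have noEQ : ∀ κ : ZMod 2, (∀ x, qform (B.D c') (fun j => I.vars j 2) (fun j => I.vars j 3) x = q x + κ) → False := by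
    intro κ hκ
    have hDD : B.D c' = B.D c := by
      refine eq_of_qform_eq I hI hS (κ := gam B c + κ₁ + κ) fun x => ?_
      rw [hκ x]
      show uval I B.y (B.D c) c x + κ₁ + κ = _
      rw [hu]
      ring
    have hcD'' : c' ∉ B.D c := hDD ▸ hcD'
    exact hne (eq_of_fundamental_eq I hI hS hcD hcD'' (hW.hDeven c hc) (hDD ▸ hW.hDeven c' hc'))
  rcases forcing_cases hqB (qform_add' I (B.D c')) hrank' hZ with h1 | ⟨κ, hκ⟩ | ⟨ν₁, ν₂, hν₁, hν₂, κ, h⟩ | ⟨a, b, -, hqf, -⟩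
  · -- `q ≡ 1`: `Q_{D c}` would be constant
    obtain ⟨v, hv⟩ := exists_ne_of_rank_four (qform_add' I (B.D c)) hrank
    apply hv
    have e1 := h1 v
    have e0 := h1 0
    have huv := hu c v
    have hu0 := hu c 0
    rw [hq] at e1 e0
    dsimp only at e1 e0
    rw [huv] at e1
    rw [hu0] at e0
    revert e1 e0
    generalize qform (B.D c) (fun j => I.vars j 2) (fun j => I.vars j 3) v = s
    generalize qform (B.D c) (fun j => I.vars j 2) (fun j => I.vars j 3) (0 : Fin n → ZMod 2) = s₀
    generalize gam B c = g; generalize κ₁ = k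
    revert s s₀ g k; decide
  · exact (noEQ κ hκ).elim
  · -- (EXC): a unit straddling the cycle of `c` — impossible
    rcases exc_unit_core I hI hS hB hW hr' hc' heG ((1 : ZMod 2), (0 : ZMod 2)) hqB hZ hν₁ hν₂ h with
        ⟨κ', hκ'⟩ | ⟨j₁, j₂, σ, τ, hne12, hDe, hdisj, hσ, hτ, -, hform, g, hg, hσg, hτg⟩
    · exact (noEQ κ' hκ').elim
    · have hfm : ∀ G : Finset (Fin m), G = ∅ → freeMon I B.N G = ∅ := fun G hG => by
        rw [hG]; unfold PstarChordBridgeForcing.freeMon; exact filter_empty _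
      rw [hT₁, hfm B.G₁ hG₁, hT₂, hfm B.G₂ hG₂, empty_union, union_empty, empty_union] at hg
      -- `g ∈ D c`; the AND-adjacency of `D c` is that of `D c'` plus the pair `{σ, τ}`
      have hστ : σ ≠ τ := fun e => disjoint_left.1 hdisj hσ (e ▸ hτ)
      have hadj : ∀ v w : Fin n, (AndAdj I (B.D c) v w ↔ ¬ (AndAdj I (B.D c') v w ↔ ((v = σ ∧ w = τ) ∨ (v = τ ∧ w = σ)))) := by
        intro v w
        have e := hform v w
        rw [hpol, polar_basis I hI hS] at e
        by_cases h1 : AndAdj I (B.D c) v w <;> by_cases h2 : AndAdj I (B.D c') v w <;>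
          by_cases h3 : (v = σ ∧ w = τ) ∨ (v = τ ∧ w = σ) <;> simp only [h1, h2, h3, if_true, if_false] at e ⊢ <;>
          first | exact absurd e (by decide) | simp
      -- the pair `{σ, τ}` is the AND pair of `g` and of no member of `D c'`
      have hpair_g : ∀ j : Fin m, ((I.vars j 2 = σ ∧ I.vars j 3 = τ) ∨ (I.vars j 2 = τ ∧ I.vars j 3 = σ)) → j = g := by
        intro j hj
        by_contra hjg
        refine andPair_ne I hI hS hjg ?_
        rcases (mem_andPair_iff I g σ).1 hσg with hs | hs <;> rcases (mem_andPair_iff I g τ).1 hτg with ht | ht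
        · exact absurd (hs.trans ht.symm) hστ
        · rcases hj with ⟨h2, h3⟩ | ⟨h2, h3⟩
          · exact Or.inl ⟨h2.trans hs, h3.trans ht⟩
          · exact Or.inr ⟨h2.trans ht, h3.trans hs⟩
        · rcases hj with ⟨h2, h3⟩ | ⟨h2, h3⟩
          · exact Or.inr ⟨h2.trans hs, h3.trans ht⟩
          · exact Or.inl ⟨h2.trans ht, h3.trans hs⟩
        · exact absurd (hs.trans ht.symm) hστ
      have hnot₁ : ¬ ((I.vars j₁ 2 = σ ∧ I.vars j₁ 3 = τ) ∨ (I.vars j₁ 2 = τ ∧ I.vars j₁ 3 = σ)) := by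
        rintro (⟨-, h3⟩ | ⟨h2, -⟩)
        · exact disjoint_left.1 hdisj ((mem_andPair_iff I j₁ τ).2 (Or.inr h3.symm)) hτ
        · exact disjoint_left.1 hdisj ((mem_andPair_iff I j₁ τ).2 (Or.inl h2.symm)) hτ
      have hnot₂ : ¬ ((I.vars j₂ 2 = σ ∧ I.vars j₂ 3 = τ) ∨ (I.vars j₂ 2 = τ ∧ I.vars j₂ 3 = σ)) := by
        rintro (⟨h2, -⟩ | ⟨-, h3⟩)
        · exact disjoint_left.1 hdisj hσ ((mem_andPair_iff I j₂ σ).2 (Or.inl h2.symm))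
        · exact disjoint_left.1 hdisj hσ ((mem_andPair_iff I j₂ σ).2 (Or.inr h3.symm))
      have hg₁ : g ≠ j₁ := fun e => hnot₁ (by
        rw [← e]
        rcases (mem_andPair_iff I g σ).1 hσg with hs | hs <;> rcases (mem_andPair_iff I g τ).1 hτg with ht | ht
        · exact absurd (hs.trans ht.symm) hστ
        · exact Or.inl ⟨hs.symm, ht.symm⟩
        · exact Or.inr ⟨ht.symm, hs.symm⟩
        · exact absurd (hs.trans ht.symm) hστ)
      have hg₂ : g ≠ j₂ := fun e => hnot₂ (by
        rw [← e]
        rcases (mem_andPair_iff I g σ).1 hσg with hs | hs <;> rcases (mem_andPair_iff I g τ).1 hτg with ht | ht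
        · exact absurd (hs.trans ht.symm) hστ
        · exact Or.inl ⟨hs.symm, ht.symm⟩
        · exact Or.inr ⟨ht.symm, hs.symm⟩
        · exact absurd (hs.trans ht.symm) hστ)
      have hgD' : g ∉ B.D c' := by
        rw [hDe, mem_insert, mem_singleton]
        rintro (e | e)
        · exact hg₁ e
        · exact hg₂ e
      -- `D c = D c' + g`
      have hDc : B.D c = insert g (B.D c') := by
        ext j
        rw [mem_insert]
        constructor
        · intro hj
          have ha := (andAdj_iff_mem I hI hS (B.D c) j).2 hj
          rw [hadj] at ha
          by_cases h2 : AndAdj I (B.D c') (I.vars j 2) (I.vars j 3)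
          · exact Or.inr ((andAdj_iff_mem I hI hS (B.D c') j).1 h2)
          · have h3 : (I.vars j 2 = σ ∧ I.vars j 3 = τ) ∨ (I.vars j 2 = τ ∧ I.vars j 3 = σ) := by
              by_contra h3; exact ha ⟨fun h => absurd h h2, fun h => absurd h h3⟩
            exact Or.inl (hpair_g j h3)
        · rintro (rfl | hj)
          · exact hg
          · refine (andAdj_iff_mem I hI hS (B.D c) j).1 ((hadj _ _).2 fun hiff => ?_)
            have ha' := (andAdj_iff_mem I hI hS (B.D c') j).2 hj
            have h3 := hiff.1 ha'
            have : j = g := hpair_g j h3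
            exact hgD' (this ▸ hj)
      have hgJ : g ∈ B.J₀ \ B.N := hW.hD c hc hg
      have hgc : g ≠ c := fun e => (mem_sdiff.1 hgJ).2 (e ▸ hc)
      exact (false_of_straddle I hI hS hcD (hW.hDeven c hc) hgc hDc hgD' hDe hg₁ hg₂ hσ hτ hσg hτg).elim
  · -- (NOR): `q` would be a product plus one, of rank ≤ 2
    exact (not_rank_four_of_mul hqB' (PstarUnionRankSix.isAffineFn_polar_left (polarDir I B ((1 : ZMod 2), (0 : ZMod 2))) b (q b + q 0))
      (PstarUnionRankSix.isAffineFn_polar_left (polarDir I B ((1 : ZMod 2), (0 : ZMod 2))) a (q a + q 0)) (κ := 1) hqf hrank).elim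

/-! ## CORE — chord-pair surjectivity -/

/-- **CORE — CHORD-PAIR SURJECTIVITY.**  For distinct chords `c ≠ c'` of a maximal peelable `F ⊆ J₀` (pure typed, simple overlaps, `(r,3/2)`-expanding, `#J₀ < r`), and any
target pattern `(α, β)`, there is an assignment solving `J₀ − c − c'` with all four privates `1` under which `c` is satisfied iff `α` and `c'` is satisfied iff `β`. -/
theorem chordPair_surjective (I : LocalMap 4 n m) (hI : I.IsPure xorAndPred) (hT : Typed I) (hS : SimpleOverlap I) {r : ℕ} (hE : BoundaryExpanding r I)
    {y : Fin m → Bool} {J₀ : Finset (Fin m)} (_hX : XorClosed I J₀) (hr : J₀.card < r)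
    {F : Finset (Fin m)} (hF : F ⊆ J₀) (hP : Peelable I F) (hmax : ∀ F', F ⊆ F' → F' ⊆ J₀ → Peelable I F' → F' = F)
    (hchord : ∀ e ∈ J₀ \ F, IsChord I J₀ e) {c c' : Fin m} (hc : c ∈ J₀ \ F) (hc' : c' ∈ J₀ \ F) (hne : c ≠ c') (α β : Bool) :
    ∃ x : Fin n → Bool, (∀ j ∈ J₀, j ≠ c → j ≠ c' → I.eval x j = y j) ∧
      x (I.vars c 2) = true ∧ x (I.vars c 3) = true ∧ x (I.vars c' 2) = true ∧ x (I.vars c' 3) = true ∧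
      (I.eval x c = y c ↔ α = true) ∧ (I.eval x c' = y c' ↔ β = true) := by
  classical
  obtain ⟨B, hy, hJ, hN, hT₁, hG₁, hT₂, hG₂, hW, hL⟩ := exists_cycleData I hI hT y hF hP hmax hchord hc
  subst hy hJ
  have hcN : c ∈ B.N := by rw [hN]; exact hc
  have hc'N : c' ∈ B.N := by rw [hN]; exact hc'
  obtain ⟨a, ha, ha'⟩ := exists_base I hI hS hE hW hr.le hcN hc'N hne hT₁ hG₁ hT₂ hG₂ (bit α) (bit β)
  -- lift the base point and set the private pairs
  obtain ⟨z₁, hz₁, hz₁x⟩ := hL fun v => toBool (a v)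
  set s : Fin m → Bool × Bool := fun e =>
    if e = c ∨ e = c' then (true, true) else (toBool ((sys I B).u e a), toBool ((sys I B).u e a)) with hs
  set z : Fin n → Bool := setPriv I B.N s z₁ with hz
  have hzF : ∀ j ∈ B.J₀ \ B.N, I.eval z j = B.y j := fun j hj => by
    rw [hz, eval_setPriv_of_mem_sdiff I hW.hN hW.hchord s z₁ hj]; exact hz₁ j hj
  have hagree : ∀ v, v ∉ xverts I (B.J₀ \ B.N) → v ∉ privs I B.N → (fun v => bit (z v)) v = a v := by
    intro v hvx hvp
    show bit (z v) = a v
    rw [hz, setPriv_of_not_mem I s z₁ hvp, hz₁x v hvx, bit_toBool]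
  have hu : ∀ e ∈ B.N, (sys I B).u e (fun v => bit (z v)) = (sys I B).u e a := fun e he => by
    rw [sys_u, sys_u]; exact uval_congr I hT hW he hagree
  have h2 : ∀ e ∈ B.N, z (I.vars e 2) = (s e).1 := fun e he => by rw [hz]; exact setPriv_two I hW.hN hW.hchord s z₁ he
  have h3 : ∀ e ∈ B.N, z (I.vars e 3) = (s e).2 := fun e he => by rw [hz]; exact setPriv_three I hI hW.hN hW.hchord s z₁ he
  have hsc : s c = (true, true) := by rw [hs]; exact if_pos (Or.inl rfl)
  have hsc' : s c' = (true, true) := by rw [hs]; exact if_pos (Or.inr rfl)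
  have ebit : ∀ t : ZMod 2, ∀ b : Bool, (bit true * bit true = t ↔ b = true) ↔ t = bit b := by decide
  refine ⟨z, fun j hj hjc hjc' => ?_, ?_, ?_, ?_, ?_, ?_, ?_⟩
  · by_cases hjN : j ∈ B.N
    · rw [eval_iff_adm I hI hW hzF hjN, h2 j hjN, h3 j hjN, hu j hjN, hs]
      dsimp only
      rw [if_neg (not_or.2 ⟨hjc, hjc'⟩)]
      dsimp only
      rw [bit_toBool]
      generalize (sys I B).u j a = t
      revert t; decide
    · exact hzF j (mem_sdiff.2 ⟨hj, hjN⟩)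
  · rw [h2 c hcN, hsc]
  · rw [h3 c hcN, hsc]
  · rw [h2 c' hc'N, hsc']
  · rw [h3 c' hc'N, hsc']
  · rw [eval_iff_adm I hI hW hzF hcN, h2 c hcN, h3 c hcN, hu c hcN, hsc, sys_u, ha]
    exact (ebit _ _).2 rfl
  · rw [eval_iff_adm I hI hW hzF hc'N, h2 c' hc'N, h3 c' hc'N, hu c' hc'N, hsc', sys_u, ha']
    exact (ebit _ _).2 rfl

end Summit.PneNP.PneNP.Theorems.PstarUnionChordPair
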